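import Summits.ResolutionOfSingularities.ResolutionOfSingularities.Theorems.RadicialJungCleanModelsCcurveUnitCase
import Summits.ResolutionOfSingularities.ResolutionOfSingularities.Theorems.RadicialJungCleanModelsCcurvePDegreeRep
import HarnessLib

/-!
# Route `RadicialJung`, crux `CleanModels` (stmt-15917) — (C-curve) sub-line, brick S5a (combined): the unit case from the `p`-degree of the fraction field

Lead `res-B-lead-1` g6 (plan `Cruxes/CleanModels/Lines/Sketch-memo-Ccurve-plan.md` §1 S5a).  OURS · counted 0.  Nothing here proves resolution in
characteristic `p`; resolution in char `p` is NOT proved.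

`D` a discrete valuation ring of characteristic `p` with uniformizer `z`, PERFECT residue field, and fraction field `κ` of `p`-degree `[κ : κ^p] = p` (e.g. the local
ring of a regular point of a curve over a perfect field); `w ∈ D` not a `p`-th power in `κ`.  Then `w − c^p = u · z^i` for some `c ∈ D`, a unit `u`, and `p ∤ i`
(`exists_sub_pow_eq_unit_mul_pow_of_finrank`) — ✓ `Ccurve.exists_sum_pow_mul_pow` (the representation `w = Σ (a_j/b_j)^p z^j` in `κ`), denominators cleared inside
`D`, then ✓ `Ccurve.exists_sub_pow_eq_unit_mul_pow`.  Also: a uniformizer is not a `p`-th power in `κ` (`uniformizer_not_pow`).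
-/

noncomputable section

set_option linter.dupNamespace false

open IsDiscreteValuationRing

namespace Summit.ResolutionOfSingularities.ResolutionOfSingularities.Theorems.RadicialJung.CleanModels.Ccurve

variable {D : Type} [CommRing D] [IsDomain D] [IsDiscreteValuationRing D] {κ : Type} [Field κ] [Algebra D κ] [IsFractionRing D κ]
variable (p : ℕ) [hp : Fact p.Prime]

/-- A uniformizer of a discrete valuation ring is not a `p`-th power in the fraction field (`p ≥ 2`): `a^p = z b^p` is impossible by counting values
mod `p`. [folklore] -/
theorem uniformizer_not_pow {z : D} (hz : Irreducible z) : ∀ y : κ, y ^ p ≠ algebraMap D κ z := by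
  intro y hy
  obtain ⟨a, b, hb, rfl⟩ := IsFractionRing.div_surjective (A := D) y
  have hb0 : (b : D) ≠ 0 := nonZeroDivisors.ne_zero hb
  have hbκ : algebraMap D κ b ≠ 0 := fun h => hb0 ((IsFractionRing.injective D κ) (by rw [h, map_zero]))
  have hab : a ^ p = z * b ^ p := by
    apply IsFractionRing.injective D κ
    rw [map_pow, map_mul, map_pow]
    rw [div_pow, div_eq_iff (pow_ne_zero _ hbκ)] at hy
    exact hy
  have hval := congrArg (addVal D) hab
  rw [addVal_pow, addVal_mul, addVal_pow, addVal_uniformizer hz] at hval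
  have hbfin : addVal D b ≠ ⊤ := by rw [Ne, addVal_eq_top_iff]; exact hb0
  have ha0 : a ≠ 0 := by
    rintro rfl
    rw [zero_pow hp.out.ne_zero] at hab
    rcases mul_eq_zero.mp hab.symm with h | h
    · exact hz.ne_zero h
    · exact hb0 ((pow_eq_zero_iff hp.out.ne_zero).mp h)
  have hafin : addVal D a ≠ ⊤ := by rw [Ne, addVal_eq_top_iff]; exact ha0
  obtain ⟨m, hm⟩ := ENat.ne_top_iff_exists.mp hafin
  obtain ⟨n, hn⟩ := ENat.ne_top_iff_exists.mp hbfin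
  rw [← hm, ← hn] at hval
  have h' : p * m = 1 + p * n := by
    rw [nsmul_eq_mul, nsmul_eq_mul] at hval
    exact_mod_cast hval
  have h1 : (p * m) % p = 0 := Nat.mul_mod_right p m
  have h2 : (1 + p * n) % p = 1 := by rw [Nat.add_mul_mod_self_left, Nat.mod_eq_of_lt hp.out.one_lt]
  rw [h'] at h1
  omega

/-- **S5a of the (C-curve) plan, combined form.**  `D` a DVR of characteristic `p` with uniformizer `z`, perfect residue field, fraction field `κ` with
`[κ : κ^p] = p`; `w ∈ D` not a `p`-th power in `κ` ⟹ `w − c^p = u · z^i` with `c ∈ D`, `u` a unit, `p ∤ i`. [folklore] -/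
theorem exists_sub_pow_eq_unit_mul_pow_of_finrank [CharP D p] [CharP κ p] {z : D} (hz : Irreducible z)
    (hperf : ∀ u : D, ∃ e : D, u - e ^ p ∈ IsLocalRing.maximalIdeal D)
    (hdeg : Module.finrank (frobenius κ p).fieldRange κ = p)
    (w : D) (hw : ∀ y : κ, y ^ p ≠ algebraMap D κ w) :
    ∃ (c : D) (i : ℕ) (u : Dˣ), ¬ p ∣ i ∧ w - c ^ p = u * z ^ i := by
  classical
  -- the representation in `κ`
  obtain ⟨f, hf⟩ := exists_sum_pow_mul_pow p hdeg (algebraMap D κ z) (uniformizer_not_pow p hz) (algebraMap D κ w)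
  -- numerators and denominators
  have hfrac : ∀ j : Fin p, ∃ ab : D × D, ab.2 ≠ 0 ∧ f j = algebraMap D κ ab.1 / algebraMap D κ ab.2 := by
    intro j
    obtain ⟨a, b, hb, hab⟩ := IsFractionRing.div_surjective (A := D) (f j)
    exact ⟨(a, b), nonZeroDivisors.ne_zero hb, hab.symm⟩
  choose ab hab using hfrac
  set e : D := ∏ j : Fin p, (ab j).2 with he
  have he0 : e ≠ 0 := Finset.prod_ne_zero_iff.mpr fun j _ => (hab j).1
  -- `ws j := a_j · ∏_{i ≠ j} b_i`
  set ws : Fin p → D := fun j => (ab j).1 * ∏ i ∈ Finset.univ.erase j, (ab i).2 with hws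
  have hκ : ∀ j : Fin p, algebraMap D κ (ws j) = algebraMap D κ e * f j := by
    intro j
    have hb0 : algebraMap D κ (ab j).2 ≠ 0 := fun h =>
      (hab j).1 ((IsFractionRing.injective D κ) (by rw [h, map_zero]))
    rw [hws, (hab j).2, he, map_mul, map_prod, ← Finset.mul_prod_erase _ _ (Finset.mem_univ j), map_mul, map_prod]
    field_simp
  have hrep : e ^ p * w = ∑ j : Fin p, ws j ^ p * z ^ (j : ℕ) := by
    apply IsFractionRing.injective D κ
    rw [map_mul, map_pow, hf, map_sum, Finset.mul_sum]
    refine Finset.sum_congr rfl fun j _ => ?_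
    rw [map_mul, map_pow, map_pow, hκ j, mul_pow]
    ring
  -- some coefficient with `j ≠ 0` is non-zero, else `w` is a `p`-th power in `κ`
  have hj : ∃ j₀ : Fin p, (j₀ : ℕ) ≠ 0 ∧ ws j₀ ≠ 0 := by
    by_contra hall
    push Not at hall
    have h0 : (⟨0, hp.out.pos⟩ : Fin p) ∈ (Finset.univ : Finset (Fin p)) := Finset.mem_univ _
    have hsum : e ^ p * w = ws ⟨0, hp.out.pos⟩ ^ p := by
      rw [hrep, ← Finset.add_sum_erase _ _ h0]
      simp only [pow_zero, mul_one, add_eq_left]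
      refine Finset.sum_eq_zero fun j hj => ?_
      have hj0 : (j : ℕ) ≠ 0 := fun h => (Finset.ne_of_mem_erase hj) (Fin.ext h)
      rw [hall j hj0, zero_pow hp.out.ne_zero, zero_mul]
    have heκ : algebraMap D κ e ≠ 0 := fun h => he0 ((IsFractionRing.injective D κ) (by rw [h, map_zero]))
    apply hw (algebraMap D κ (ws ⟨0, hp.out.pos⟩) / algebraMap D κ e)
    rw [div_pow, div_eq_iff (pow_ne_zero _ heκ), ← map_pow, ← map_pow, ← map_mul, mul_comm, hsum]
  obtain ⟨j₀, hj₀, hw₀⟩ := hj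
  exact exists_sub_pow_eq_unit_mul_pow p hz hperf w e ws hrep j₀ hj₀ hw₀

end Summit.ResolutionOfSingularities.ResolutionOfSingularities.Theorems.RadicialJung.CleanModels.Ccurve

end
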